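import Summits.AnomalousDissipation.AnomalousDissipation.Theorems.MomentParityQuarticGateDesignSymAtoms
import Summits.AnomalousDissipation.AnomalousDissipation.Theorems.MomentParityQuarticGateAtomicMeasure

/-!
# The explicit order-2 design: the uniform law on the atoms

Helper file for stub S6′ (`stub_order2DesignSym`) of the line `axis-sectors` of crux
`MomentParity.QuarticGate`, continuing `MomentParityQuarticGateDesignSymAtoms` (same coefficient
families, atoms `U p ∈ H` and force `f` with Fourier coefficients `cf`). The order-2 design is the
UNIFORM law `μ = (#ι)⁻¹ ∑ₚ δ_{U p}` on the atoms; this file derives its clauses from the summed rows: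
level `N`, bounded support, NONDEGENERATE covariance (two atoms with opposite noise sign are
separated), vanishing LINEAR rows (`π A₁ B₂ = 1 - 4π²ν`), vanishing ENERGY row (under the enstrophy
balance `hbal`, which is how the carrier amplitude `c` is tuned), vanishing HELICITY row, the mean
energy bound and the dissipation `= 1/2`.
-/

namespace Summit.AnomalousDissipation.AnomalousDissipation.Theorems.MomentParityQuarticGate

open MeasureTheory Filter Complex
open scoped InnerProductSpace RealInnerProductSpace ComplexConjugate ENNReal
open Literature.Analysis.FunctionSpaces Literature.Analysis.FluidPDE
open Summit.AnomalousDissipation.AnomalousDissipation.Theorems.QuarticGate.Negative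

set_option linter.dupNamespace false

noncomputable section

section Law

variable {N : ℕ} {A₁ B₂ c η : ℝ}
  {cf cC : (Fin 3 → ℤ) → EuclideanSpace ℂ (Fin 3)} {cA cB : Fin 4 → (Fin 3 → ℤ) → EuclideanSpace ℂ (Fin 3)}
  {cR : Torus.FrameIdx (Fin 3) N → (Fin 3 → ℤ) → EuclideanSpace ℂ (Fin 3)}
  (hcf : cf = (Pi.single (![0, 1, 0] : Fin 3 → ℤ) (((1 / 2 : ℂ)) • EuclideanSpace.complexify (WithLp.toLp 2 ![(1 : ℝ), 0, 0] : EuclideanSpace ℝ (Fin 3))) +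
        Pi.single (-(![0, 1, 0] : Fin 3 → ℤ)) ((starRingEnd ℂ) ((1 / 2 : ℂ)) • EuclideanSpace.complexify (WithLp.toLp 2 ![(1 : ℝ), 0, 0] : EuclideanSpace ℝ (Fin 3))) : (Fin 3 → ℤ) → EuclideanSpace ℂ (Fin 3)))
  (hcA : cA = fun m : Fin 4 => (Pi.single (![0, 0, 1] : Fin 3 → ℤ) ((((A₁ / 2 : ℝ) : ℂ) * Complex.I ^ (m : ℕ)) • EuclideanSpace.complexify (WithLp.toLp 2 ![(1 : ℝ), 0, 0] : EuclideanSpace ℝ (Fin 3))) +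
        Pi.single (-(![0, 0, 1] : Fin 3 → ℤ)) ((starRingEnd ℂ) (((A₁ / 2 : ℝ) : ℂ) * Complex.I ^ (m : ℕ)) • EuclideanSpace.complexify (WithLp.toLp 2 ![(1 : ℝ), 0, 0] : EuclideanSpace ℝ (Fin 3))) : (Fin 3 → ℤ) → EuclideanSpace ℂ (Fin 3)))
  (hcB : cB = fun m : Fin 4 => (Pi.single (![0, 1, 1] : Fin 3 → ℤ) ((((B₂ / 2 : ℝ) : ℂ) * -Complex.I * Complex.I ^ (m : ℕ)) • EuclideanSpace.complexify (WithLp.toLp 2 ![(0 : ℝ), 1, -1] : EuclideanSpace ℝ (Fin 3))) +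
        Pi.single (-(![0, 1, 1] : Fin 3 → ℤ)) ((starRingEnd ℂ) (((B₂ / 2 : ℝ) : ℂ) * -Complex.I * Complex.I ^ (m : ℕ)) • EuclideanSpace.complexify (WithLp.toLp 2 ![(0 : ℝ), 1, -1] : EuclideanSpace ℝ (Fin 3))) : (Fin 3 → ℤ) → EuclideanSpace ℂ (Fin 3)))
  (hcC : cC = (Pi.single (![0, 0, (N : ℤ)] : Fin 3 → ℤ) ((((c / 2 : ℝ) : ℂ)) • EuclideanSpace.complexify (WithLp.toLp 2 ![(1 : ℝ), 0, 0] : EuclideanSpace ℝ (Fin 3))) +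
        Pi.single (-(![0, 0, (N : ℤ)] : Fin 3 → ℤ)) ((starRingEnd ℂ) (((c / 2 : ℝ) : ℂ)) • EuclideanSpace.complexify (WithLp.toLp 2 ![(1 : ℝ), 0, 0] : EuclideanSpace ℝ (Fin 3))) : (Fin 3 → ℤ) → EuclideanSpace ℂ (Fin 3)))
  (hcR : cR = fun a : Torus.FrameIdx (Fin 3) N => (Pi.single (a.1 : Fin 3 → ℤ) ((((η / 2 : ℝ) : ℂ) * (if a.2.2 then (1 : ℂ) else -Complex.I)) • EuclideanSpace.complexify (Torus.perpVec (a.1 : Fin 3 → ℤ) a.2.1)) +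
        Pi.single (-(a.1 : Fin 3 → ℤ)) ((starRingEnd ℂ) (((η / 2 : ℝ) : ℂ) * (if a.2.2 then (1 : ℂ) else -Complex.I)) • EuclideanSpace.complexify (Torus.perpVec (a.1 : Fin 3 → ℤ) a.2.1)) : (Fin 3 → ℤ) → EuclideanSpace ℂ (Fin 3)))
  {U : (Fin 4 × Torus.FrameIdx (Fin 3) N × Bool × Bool) → Torus.energySpace (Fin 3)}
  (hU : ∀ p, (((U p).1 : Lp (EuclideanSpace ℝ (Fin 3)) 2 (volume : Measure (UnitAddTorus (Fin 3)))) :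
      UnitAddTorus (Fin 3) → EuclideanSpace ℝ (Fin 3)) =ᵐ[volume]
    Torus.realTrigPoly ((Torus.freqBall N).erase 0)
      (cf + cA p.1 + cB p.1 + (if p.2.2.1 then (1 : ℝ) else -1) • cC + (if p.2.2.2 then (1 : ℝ) else -1) • cR p.2.1))
  {f : UnitAddTorus (Fin 3) → EuclideanSpace ℝ (Fin 3)} (hf : Torus.IsSmooth f)
  (hfF : ∀ k, UnitAddTorus.mFourierCoeff (EuclideanSpace.complexify ∘ f) k = cf k)

/-- The design index set is non-empty at every level `N ≥ 2`. [folklore] -/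
theorem design_index_nonempty (hN : 2 ≤ N) : Nonempty (Fin 4 × Torus.FrameIdx (Fin 3) N × Bool × Bool) := by
  obtain ⟨hkF, -⟩ := design_mem hN
  exact ⟨(0, (⟨(![0, 1, 0] : Fin 3 → ℤ), hkF⟩, 0, true), true, true)⟩

include hcf hcA hcB hcC hcR hU in
/-- **The uniform law on the atoms is carried by level-`N` fields.** [folklore] -/
theorem design_measure_isLevel :
    ∀ᵐ u ∂(((Fintype.card (Fin 4 × Torus.FrameIdx (Fin 3) N × Bool × Bool) : ℝ≥0∞))⁻¹ • ∑ p, Measure.dirac (U p)), IsLevel N u :=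
  ae_average U fun p => level_of_ae_eq (hU p) (design_isConjSymm hcf hcA hcB hcC hcR p)

include hcR hU in
/-- **NONDEGENERATE COVARIANCE of the uniform law on the atoms** (`η ≠ 0`): every band test of level
`N` that does not vanish identically on `H` has positive variance. [folklore] -/
theorem design_measure_nondegenerate (hN : 2 ≤ N) (hη : η ≠ 0) (g : UnitAddTorus (Fin 3) → EuclideanSpace ℝ (Fin 3))
    (hg : IsBandTest N g) (hex : ∃ u : Torus.energySpace (Fin 3), IsLevel N u ∧ Torus.pairing u.1 g ≠ 0) :
    (∫ u : Torus.energySpace (Fin 3), Torus.pairing u.1 g ∂(((Fintype.card (Fin 4 × Torus.FrameIdx (Fin 3) N × Bool × Bool) : ℝ≥0∞))⁻¹ • ∑ p, Measure.dirac (U p))) ^ 2 <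
      ∫ u : Torus.energySpace (Fin 3), (Torus.pairing u.1 g) ^ 2 ∂(((Fintype.card (Fin 4 × Torus.FrameIdx (Fin 3) N × Bool × Bool) : ℝ≥0∞))⁻¹ • ∑ p, Measure.dirac (U p)) := by
  haveI : Nonempty (Fin 4 × Torus.FrameIdx (Fin 3) N × Bool × Bool) := design_index_nonempty hN
  obtain ⟨a, ha⟩ := exists_frameFieldIdx_pairing_ne_zero hg (hex.imp fun u hu => hu.2)
  refine sq_integral_lt_integral_sq_average U (fun u => Torus.pairing u.1 g) ⟨(0, a, true, true), (0, a, true, false), ?_⟩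
  intro h
  have hsub := design_pairing_flip (cf := cf) (cA := cA) (cB := cB) (cC := cC) hcR hU 0 a true hg.1
  rw [h, sub_self] at hsub
  have : (2 * η) * ∫ x, ⟪Torus.frameFieldIdx N a x, g x⟫_ℝ ≠ 0 := mul_ne_zero (mul_ne_zero two_ne_zero hη) ha
  exact this hsub.symm

include hcf hcA hcB hcC hcR hU hf hfF in
/-- **The LINEAR rows of the uniform law on the atoms vanish** (`π A₁ B₂ = 1 - 4π²ν`). [folklore] -/
theorem design_measure_linearRow (hN : 2 ≤ N) (ν : ℝ) (hAB : Real.pi * A₁ * B₂ = 1 - 4 * Real.pi ^ 2 * ν)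
    (g : UnitAddTorus (Fin 3) → EuclideanSpace ℝ (Fin 3)) (hg : IsBandTest N g) :
    Integrable (fun u : Torus.energySpace (Fin 3) => Torus.nsGeneratorPairing ν f u g)
        (((Fintype.card (Fin 4 × Torus.FrameIdx (Fin 3) N × Bool × Bool) : ℝ≥0∞))⁻¹ • ∑ p, Measure.dirac (U p)) ∧
      ∫ u : Torus.energySpace (Fin 3), Torus.nsGeneratorPairing ν f u g
        ∂(((Fintype.card (Fin 4 × Torus.FrameIdx (Fin 3) N × Bool × Bool) : ℝ≥0∞))⁻¹ • ∑ p, Measure.dirac (U p)) = 0 := by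
  haveI : Nonempty (Fin 4 × Torus.FrameIdx (Fin 3) N × Bool × Bool) := design_index_nonempty hN
  refine ⟨integrable_average U _, ?_⟩
  rw [integral_average U, symDesign_sum_linearRow hcf hcA hcB hcC hcR hU hf hfF hN ν hAB hg, mul_zero]

include hcf hcA hcB hcC hcR hU hf hfF in
/-- **The ENERGY row of the uniform law on the atoms vanishes** under the enstrophy balance
`#ι/2 = 4π²ν (#ι (1/2 + A₁²/2 + 2B₂² + N²c²/2) + 16 ∑ₐ ∑ |k|² ‖cR a k‖²)`. [folklore] -/
theorem design_measure_energyRow (hN : 2 ≤ N) (ν : ℝ)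
    (hbal : ((Fintype.card (Fin 4 × Torus.FrameIdx (Fin 3) N × Bool × Bool) : ℕ) : ℝ) * (1 / 2) =
      ν * (4 * Real.pi ^ 2 * (((Fintype.card (Fin 4 × Torus.FrameIdx (Fin 3) N × Bool × Bool) : ℕ) : ℝ) *
          (1 / 2 + A₁ ^ 2 / 2 + 2 * B₂ ^ 2 + (N : ℝ) ^ 2 * c ^ 2 / 2) +
          16 * ∑ a : Torus.FrameIdx (Fin 3) N, ∑ k ∈ ((Torus.freqBall N).erase 0), Torus.freqNormSq k * ‖(cR a) k‖ ^ 2))) :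
    Integrable (fun u : Torus.energySpace (Fin 3) => Torus.nsGeneratorPairing ν f u
        (Torus.fourierTruncate N (u.1 : UnitAddTorus (Fin 3) → EuclideanSpace ℝ (Fin 3))))
        (((Fintype.card (Fin 4 × Torus.FrameIdx (Fin 3) N × Bool × Bool) : ℝ≥0∞))⁻¹ • ∑ p, Measure.dirac (U p)) ∧
      ∫ u : Torus.energySpace (Fin 3), Torus.nsGeneratorPairing ν f u
        (Torus.fourierTruncate N (u.1 : UnitAddTorus (Fin 3) → EuclideanSpace ℝ (Fin 3)))
        ∂(((Fintype.card (Fin 4 × Torus.FrameIdx (Fin 3) N × Bool × Bool) : ℝ≥0∞))⁻¹ • ∑ p, Measure.dirac (U p)) = 0 := by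
  haveI : Nonempty (Fin 4 × Torus.FrameIdx (Fin 3) N × Bool × Bool) := design_index_nonempty hN
  refine ⟨integrable_average U _, ?_⟩
  rw [integral_average U, symDesign_sum_energyRow hcf hcA hcB hcC hcR hU hf hfF hN ν, hbal, sub_self, mul_zero]

include hcf hcA hcB hcC hcR hU hf hfF in
/-- **The HELICITY row of the uniform law on the atoms vanishes.** [folklore] -/
theorem design_measure_helicityRow (hN : 2 ≤ N) (ν : ℝ) :
    Integrable (fun u : Torus.energySpace (Fin 3) => Torus.nsGeneratorPairing ν f u
        (BDSV.curl (Torus.fourierTruncate N (u.1 : UnitAddTorus (Fin 3) → EuclideanSpace ℝ (Fin 3)))))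
        (((Fintype.card (Fin 4 × Torus.FrameIdx (Fin 3) N × Bool × Bool) : ℝ≥0∞))⁻¹ • ∑ p, Measure.dirac (U p)) ∧
      ∫ u : Torus.energySpace (Fin 3), Torus.nsGeneratorPairing ν f u
        (BDSV.curl (Torus.fourierTruncate N (u.1 : UnitAddTorus (Fin 3) → EuclideanSpace ℝ (Fin 3))))
        ∂(((Fintype.card (Fin 4 × Torus.FrameIdx (Fin 3) N × Bool × Bool) : ℝ≥0∞))⁻¹ • ∑ p, Measure.dirac (U p)) = 0 := by
  haveI : Nonempty (Fin 4 × Torus.FrameIdx (Fin 3) N × Bool × Bool) := design_index_nonempty hN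
  refine ⟨integrable_average U _, ?_⟩
  rw [integral_average U, symDesign_sum_helicityRow hcf hcA hcB hcC hcR hU hf hfF ν, mul_zero]

include hcf hcA hcB hcC hcR hU in
/-- **Mean energy of the uniform law on the atoms**: `≤ 1/2 + A₁²/2 + B₂² + c²/2 + η²/2`. [folklore] -/
theorem design_measure_energy_le (hN : 2 ≤ N) :
    Torus.ensembleEnergy (((Fintype.card (Fin 4 × Torus.FrameIdx (Fin 3) N × Bool × Bool) : ℝ≥0∞))⁻¹ • ∑ p, Measure.dirac (U p)) ≤
      1 / 2 + A₁ ^ 2 / 2 + B₂ ^ 2 + c ^ 2 / 2 + η ^ 2 / 2 := by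
  haveI : Nonempty (Fin 4 × Torus.FrameIdx (Fin 3) N × Bool × Bool) := design_index_nonempty hN
  rw [ensembleEnergy_average U]
  simp_rw [fun p => norm_sq_of_ae_eq (hU p) (design_isConjSymm hcf hcA hcB hcC hcR p)]
  have hn : (0 : ℝ) < Fintype.card (Fin 4 × Torus.FrameIdx (Fin 3) N × Bool × Bool) := by exact_mod_cast Fintype.card_pos
  rw [inv_mul_le_iff₀ hn]
  exact design_sum_energy_le hcf hcA hcB hcC hcR hN

include hcf hcA hcB hcC hcR hU in
/-- **Dissipation of the uniform law on the atoms**: under the enstrophy balance it is exactly `1/2`.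
[folklore] -/
theorem design_measure_dissipation (hN : 2 ≤ N) (ν : ℝ)
    (hbal : ((Fintype.card (Fin 4 × Torus.FrameIdx (Fin 3) N × Bool × Bool) : ℕ) : ℝ) * (1 / 2) =
      ν * (4 * Real.pi ^ 2 * (((Fintype.card (Fin 4 × Torus.FrameIdx (Fin 3) N × Bool × Bool) : ℕ) : ℝ) *
          (1 / 2 + A₁ ^ 2 / 2 + 2 * B₂ ^ 2 + (N : ℝ) ^ 2 * c ^ 2 / 2) +
          16 * ∑ a : Torus.FrameIdx (Fin 3) N, ∑ k ∈ ((Torus.freqBall N).erase 0), Torus.freqNormSq k * ‖(cR a) k‖ ^ 2))) :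
    Torus.ensembleDissipation ν (((Fintype.card (Fin 4 × Torus.FrameIdx (Fin 3) N × Bool × Bool) : ℝ≥0∞))⁻¹ • ∑ p, Measure.dirac (U p)) = 1 / 2 := by
  haveI : Nonempty (Fin 4 × Torus.FrameIdx (Fin 3) N × Bool × Bool) := design_index_nonempty hN
  rw [ensembleDissipation_average U ν (e := fun p => 4 * Real.pi ^ 2 * ∑ k ∈ (Torus.freqBall N).erase 0, Torus.freqNormSq k *
      ‖(cf + cA p.1 + cB p.1 + (if p.2.2.1 then (1 : ℝ) else -1) • cC + (if p.2.2.2 then (1 : ℝ) else -1) • cR p.2.1) k‖ ^ 2)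
    (fun p => mul_nonneg (by positivity) (Finset.sum_nonneg fun k _ => mul_nonneg (Torus.freqNormSq_nonneg k) (sq_nonneg _)))
    (fun p => eGradNormSq_of_ae_eq (hU p) (design_isConjSymm hcf hcA hcB hcC hcR p))]
  rw [← Finset.mul_sum, design_sum_enstrophy hcf hcA hcB hcC hN]
  have hn : (Fintype.card (Fin 4 × Torus.FrameIdx (Fin 3) N × Bool × Bool) : ℝ) ≠ 0 := by exact_mod_cast Fintype.card_ne_zero
  rw [mul_left_comm ν, ← hbal, ← mul_assoc, inv_mul_cancel₀ hn, one_mul]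

end Law

section Bundle

variable {N : ℕ} {A₁ B₂ c η : ℝ}
  {cf cC : (Fin 3 → ℤ) → EuclideanSpace ℂ (Fin 3)} {cA cB : Fin 4 → (Fin 3 → ℤ) → EuclideanSpace ℂ (Fin 3)}
  {cR : Torus.FrameIdx (Fin 3) N → (Fin 3 → ℤ) → EuclideanSpace ℂ (Fin 3)}
  (hcf : cf = (Pi.single (![0, 1, 0] : Fin 3 → ℤ) (((1 / 2 : ℂ)) • EuclideanSpace.complexify (WithLp.toLp 2 ![(1 : ℝ), 0, 0] : EuclideanSpace ℝ (Fin 3))) +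
        Pi.single (-(![0, 1, 0] : Fin 3 → ℤ)) ((starRingEnd ℂ) ((1 / 2 : ℂ)) • EuclideanSpace.complexify (WithLp.toLp 2 ![(1 : ℝ), 0, 0] : EuclideanSpace ℝ (Fin 3))) : (Fin 3 → ℤ) → EuclideanSpace ℂ (Fin 3)))
  (hcA : cA = fun m : Fin 4 => (Pi.single (![0, 0, 1] : Fin 3 → ℤ) ((((A₁ / 2 : ℝ) : ℂ) * Complex.I ^ (m : ℕ)) • EuclideanSpace.complexify (WithLp.toLp 2 ![(1 : ℝ), 0, 0] : EuclideanSpace ℝ (Fin 3))) +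
        Pi.single (-(![0, 0, 1] : Fin 3 → ℤ)) ((starRingEnd ℂ) (((A₁ / 2 : ℝ) : ℂ) * Complex.I ^ (m : ℕ)) • EuclideanSpace.complexify (WithLp.toLp 2 ![(1 : ℝ), 0, 0] : EuclideanSpace ℝ (Fin 3))) : (Fin 3 → ℤ) → EuclideanSpace ℂ (Fin 3)))
  (hcB : cB = fun m : Fin 4 => (Pi.single (![0, 1, 1] : Fin 3 → ℤ) ((((B₂ / 2 : ℝ) : ℂ) * -Complex.I * Complex.I ^ (m : ℕ)) • EuclideanSpace.complexify (WithLp.toLp 2 ![(0 : ℝ), 1, -1] : EuclideanSpace ℝ (Fin 3))) +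
        Pi.single (-(![0, 1, 1] : Fin 3 → ℤ)) ((starRingEnd ℂ) (((B₂ / 2 : ℝ) : ℂ) * -Complex.I * Complex.I ^ (m : ℕ)) • EuclideanSpace.complexify (WithLp.toLp 2 ![(0 : ℝ), 1, -1] : EuclideanSpace ℝ (Fin 3))) : (Fin 3 → ℤ) → EuclideanSpace ℂ (Fin 3)))
  (hcC : cC = (Pi.single (![0, 0, (N : ℤ)] : Fin 3 → ℤ) ((((c / 2 : ℝ) : ℂ)) • EuclideanSpace.complexify (WithLp.toLp 2 ![(1 : ℝ), 0, 0] : EuclideanSpace ℝ (Fin 3))) +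
        Pi.single (-(![0, 0, (N : ℤ)] : Fin 3 → ℤ)) ((starRingEnd ℂ) (((c / 2 : ℝ) : ℂ)) • EuclideanSpace.complexify (WithLp.toLp 2 ![(1 : ℝ), 0, 0] : EuclideanSpace ℝ (Fin 3))) : (Fin 3 → ℤ) → EuclideanSpace ℂ (Fin 3)))
  (hcR : cR = fun a : Torus.FrameIdx (Fin 3) N => (Pi.single (a.1 : Fin 3 → ℤ) ((((η / 2 : ℝ) : ℂ) * (if a.2.2 then (1 : ℂ) else -Complex.I)) • EuclideanSpace.complexify (Torus.perpVec (a.1 : Fin 3 → ℤ) a.2.1)) +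
        Pi.single (-(a.1 : Fin 3 → ℤ)) ((starRingEnd ℂ) (((η / 2 : ℝ) : ℂ) * (if a.2.2 then (1 : ℂ) else -Complex.I)) • EuclideanSpace.complexify (Torus.perpVec (a.1 : Fin 3 → ℤ) a.2.1)) : (Fin 3 → ℤ) → EuclideanSpace ℂ (Fin 3)))
  {f : UnitAddTorus (Fin 3) → EuclideanSpace ℝ (Fin 3)} (hf : Torus.IsSmooth f)
  (hfF : ∀ k, UnitAddTorus.mFourierCoeff (EuclideanSpace.complexify ∘ f) k = cf k)

include hcf hcA hcB hcC hcR hf hfF in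
/-- **THE CLAUSES OF THE ORDER-2 DESIGN, bundled**: at level `N ≥ 2`, with `η ≠ 0`, the linear-row
relation `π A₁ B₂ = 1 - 4π²ν` and the enstrophy balance, the uniform law on the atoms of the design
is a level-`N` probability law with bounded support, nondegenerate covariance, vanishing linear /
energy / helicity rows, mean energy `≤ E` and dissipation `= 1/2 ≥ ε`. [folklore] -/
theorem exists_design_measure (hN : 2 ≤ N) (hη : η ≠ 0) (ν : ℝ) (hAB : Real.pi * A₁ * B₂ = 1 - 4 * Real.pi ^ 2 * ν)
    (hbal : ((Fintype.card (Fin 4 × Torus.FrameIdx (Fin 3) N × Bool × Bool) : ℕ) : ℝ) * (1 / 2) =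
      ν * (4 * Real.pi ^ 2 * (((Fintype.card (Fin 4 × Torus.FrameIdx (Fin 3) N × Bool × Bool) : ℕ) : ℝ) *
          (1 / 2 + A₁ ^ 2 / 2 + 2 * B₂ ^ 2 + (N : ℝ) ^ 2 * c ^ 2 / 2) +
          16 * ∑ a : Torus.FrameIdx (Fin 3) N, ∑ k ∈ ((Torus.freqBall N).erase 0), Torus.freqNormSq k * ‖(cR a) k‖ ^ 2)))
    {E ε : ℝ} (hE : 1 / 2 + A₁ ^ 2 / 2 + B₂ ^ 2 + c ^ 2 / 2 + η ^ 2 / 2 ≤ E) (hε : ε ≤ 1 / 2) :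
    ∃ μ₀ : Measure (Torus.energySpace (Fin 3)), IsProbabilityMeasure μ₀ ∧ (∀ᵐ u ∂μ₀, IsLevel N u) ∧
      (∃ R : ℝ, ∀ᵐ u ∂μ₀, ‖u‖ ≤ R) ∧
      (∀ g : UnitAddTorus (Fin 3) → EuclideanSpace ℝ (Fin 3), IsBandTest N g →
        (∃ u : Torus.energySpace (Fin 3), IsLevel N u ∧ Torus.pairing u.1 g ≠ 0) →
        (∫ u : Torus.energySpace (Fin 3), Torus.pairing u.1 g ∂μ₀) ^ 2 <
          ∫ u : Torus.energySpace (Fin 3), (Torus.pairing u.1 g) ^ 2 ∂μ₀) ∧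
      (∀ g : UnitAddTorus (Fin 3) → EuclideanSpace ℝ (Fin 3), IsBandTest N g →
        Integrable (fun u : Torus.energySpace (Fin 3) => Torus.nsGeneratorPairing ν f u g) μ₀ ∧
        ∫ u : Torus.energySpace (Fin 3), Torus.nsGeneratorPairing ν f u g ∂μ₀ = 0) ∧
      (Integrable (fun u : Torus.energySpace (Fin 3) => Torus.nsGeneratorPairing ν f u
          (Torus.fourierTruncate N (u.1 : UnitAddTorus (Fin 3) → EuclideanSpace ℝ (Fin 3)))) μ₀ ∧
        ∫ u : Torus.energySpace (Fin 3), Torus.nsGeneratorPairing ν f u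
          (Torus.fourierTruncate N (u.1 : UnitAddTorus (Fin 3) → EuclideanSpace ℝ (Fin 3))) ∂μ₀ = 0) ∧
      (Integrable (fun u : Torus.energySpace (Fin 3) => Torus.nsGeneratorPairing ν f u
          (BDSV.curl (Torus.fourierTruncate N (u.1 : UnitAddTorus (Fin 3) → EuclideanSpace ℝ (Fin 3))))) μ₀ ∧
        ∫ u : Torus.energySpace (Fin 3), Torus.nsGeneratorPairing ν f u
          (BDSV.curl (Torus.fourierTruncate N (u.1 : UnitAddTorus (Fin 3) → EuclideanSpace ℝ (Fin 3)))) ∂μ₀ = 0) ∧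
      Torus.ensembleEnergy μ₀ ≤ E ∧ ε ≤ Torus.ensembleDissipation ν μ₀ := by
  choose U hU using fun p : (Fin 4 × Torus.FrameIdx (Fin 3) N × Bool × Bool) =>
    exists_energySpace_coe_ae_eq_realTrigPoly N _ (design_isTransversal hcf hcA hcB hcC hcR p)
  haveI : Nonempty (Fin 4 × Torus.FrameIdx (Fin 3) N × Bool × Bool) := design_index_nonempty hN
  exact ⟨_, isProbabilityMeasure_average U, design_measure_isLevel hcf hcA hcB hcC hcR hU, ⟨_, ae_norm_le_average U⟩,
    design_measure_nondegenerate hcR hU hN hη, design_measure_linearRow hcf hcA hcB hcC hcR hU hf hfF hN ν hAB,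
    design_measure_energyRow hcf hcA hcB hcC hcR hU hf hfF hN ν hbal, design_measure_helicityRow hcf hcA hcB hcC hcR hU hf hfF hN ν,
    (design_measure_energy_le hcf hcA hcB hcC hcR hU hN).trans hE,
    hε.trans_eq (design_measure_dissipation hcf hcA hcB hcC hcR hU hN ν hbal).symm⟩


end Bundle

/-- **Registered sub-goal `designSymMeasure_index_nonempty` of stub S6′** (summary of this file's
bookkeeping): the design index set `Fin 4 × FrameIdx × Bool × Bool` is non-empty at every level `N ≥ 2`.
[folklore] -/
theorem designSymMeasure_index_nonempty : ∀ N : ℕ, 2 ≤ N → Nonempty (Fin 4 × Torus.FrameIdx (Fin 3) N × Bool × Bool) :=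
  fun _ hN => design_index_nonempty hN

end

end Summit.AnomalousDissipation.AnomalousDissipation.Theorems.MomentParityQuarticGate
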